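import Summits.Ventures.PercRepro.RankLevelSetLevelFiveCqFifteenTwo
import Summits.Ventures.PercRepro.S2FourteenSix

/-!
# PercRepro — S2: THEOREM C₅ AT `15` MODULO THE ONE CELL `(14, 7)` (p7, gen 14; sub-claim S2)

`c025_five_large_sharp15_of_two_cells` with the cell `(14, 6)` discharged (S2FourteenSix): **`ThmN.c025_five_large_sharp15_of_one_cell
(hseven : the cell (14, 7)) (M) (p) (hp : 15 ≤ p) : RLS M p 5`**. No window move is claimed: the window of record stays
«8 ≤ p ≤ 15» until the cell `(14, 7)` is a tree theorem. Axioms: standard.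
-/

open scoped Matroid

namespace PercRepro

namespace ThmN

open Set

variable {α : Type}

/-- **THEOREM C₅ AT `15` MODULO THE CELL `(14, 7)`**. -/
theorem c025_five_large_sharp15_of_one_cell
    (hseven : ∀ (M : Matroid α) [M.Finite], M.eRank = ((14 : ℕ) : ℕ∞) → M.E.ncard = 14 + 7 →
      (∀ e ∈ M.E, ∃ A ⊆ M.E \ {e}, e ∉ M.closure A ∧ e ∉ M.closure ((M.E \ {e}) \ A)) → RLS M 14 5)
    (M : Matroid α) [M.Finite] (p : ℕ) (hp : 15 ≤ p) : RLS M p 5 := by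
  refine c025_five_large_sharp15_of_two_cells ?_ M p hp
  intro M _ d hd6 hd7 hR hn hfree
  rcases Nat.lt_or_ge d 7 with h | h
  · obtain rfl : d = 6 := by omega
    exact c025_core_five_fourteen_six M hR hn hfree
  · obtain rfl : d = 7 := by omega
    exact hseven M hR hn hfree

end ThmN

end PercRepro
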